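import Mathlib
import HarnessLib
import Summits.AtomisticToContinuum.Crystallization.Theorems.PricedLinkCensusSoftFourRingsCapCube2
import Summits.AtomisticToContinuum.Crystallization.Theorems.PricedLinkCensusSoftFourRingsCapHexagon2
import Summits.AtomisticToContinuum.Crystallization.Theorems.PricedLinkCensusSoftFourRingsCube3

/-!
# Soft four-rings, endgame: the second bonds of the frame (cuboctahedral branch)

Support file for `SoftFourRings` (route `PricedLinkCensus`, sub-problem `Crystallization`),
endgame step (E5) of the evidence file (§12.8), point-level form, every vertex of type O.  In the
frame of `cube_frame` (`N(a) = {v, b, x, a'}`, `N(b) = {v, a, y, b'}`, `N(c) = {v, d, x, c'}`,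
`N(d) = {v, c, y, d'}`, `N(x) = {a, a', c, c'}`, `N(y) = {b, b', d, d'}`):

* `frame_ne` — `a' ≠ d'` (else the eight points `v, a, b, c, d, x, y, a'` would be saturated by
  ten, `saturated_eight_false`);
* `cube_pairing` — **`a' ∼ b'`** (the cells at `a`; the alternative pairings are excluded by
  `frame_ne` and by `hα` at `v`).

Applied a second time with `(a, b, a', b')` and `(c, d, c', d')` exchanged this also gives
`c' ≠ b'` and `c' ∼ d'`.

**`Cap` variant** (seat c3 of stmt-AtomisticToContinuum-14234): identical to `PricedLinkCensusSoftFourRingsCube3`, except that the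
global Tammes-13 hypothesis `(hT : musinTarasov2012_tammes_thirteen)` is replaced by the LOCAL covering
property of the twelve directions, `hT : ∀ p, ‖p‖ = 1 → ∃ x ∈ X, dist p x < 0.957` (no empty cap of
angular radius `57.18°`), which is all the two roots (`FacetCap`, `Interior`) ever used; the hT-free
lemmas are not repeated (the original file is imported for them).
-/

namespace Summit.AtomisticToContinuum.Crystallization.Theorems.Cap

open Real RealInnerProductSpace Literature.Geometry.DiscreteGeometry

section Setting

open scoped Classical in
/-- **The second bond at the wing `a` of the frame: `a' ∼ b'`.** -/
theorem cube_pairing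
    {X : Finset (EuclideanSpace ℝ (Fin 3))}
    {B : Finset (Finset (EuclideanSpace ℝ (Fin 3)))}
    (hT : ∀ p : EuclideanSpace ℝ (Fin 3), ‖p‖ = 1 → ∃ x ∈ X, dist p x < 0.957)
    (hX1 : ∀ y ∈ X, ‖y‖ = 1)
    (hcard : X.card = 12)
    (hsepX : ∀ u ∈ X, ∀ u' ∈ X, u ≠ u' → ⟪u, u'⟫ ≤ 1 - 1 / (2 * (101 / 100 : ℝ) ^ 2))
    (hB : ∀ T ∈ B, ∃ u ∈ X, ∃ u' ∈ X, u ≠ u' ∧ 1 - (101 / 100 : ℝ) ^ 2 / 2 ≤ ⟪u, u'⟫ ∧ T = {u, u'})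
    (hBcard : B.card = 24)
    (hdeg : ∀ v ∈ X, ∃ w : Fin 4 → EuclideanSpace ℝ (Fin 3), (∀ k, w k ∈ X) ∧ Function.Injective w ∧ (∀ k, w k ≠ v) ∧ (∀ k, ({v, w k} : Finset (EuclideanSpace ℝ (Fin 3))) ∈ B) ∧ ∀ y, ({v, y} : Finset (EuclideanSpace ℝ (Fin 3))) ∈ B → ∃ k, y = w k)
    (hallO : ∀ u ∈ X, ∃ a b c d : EuclideanSpace ℝ (Fin 3), (∀ t, ({u, t} : Finset (EuclideanSpace ℝ (Fin 3))) ∈ B ↔ (t = a ∨ t = b ∨ t = c ∨ t = d)) ∧ (a ≠ b ∧ a ≠ c ∧ a ≠ d ∧ b ≠ c ∧ b ≠ d ∧ c ≠ d) ∧ ({a, b} : Finset (EuclideanSpace ℝ (Fin 3))) ∈ B ∧ ({c, d} : Finset (EuclideanSpace ℝ (Fin 3))) ∈ B ∧ ({a, c} : Finset (EuclideanSpace ℝ (Fin 3))) ∉ B ∧ ({a, d} : Finset (EuclideanSpace ℝ (Fin 3))) ∉ B ∧ ({b, c} : Finset (EuclideanSpace ℝ (Fin 3))) ∉ B ∧ ({b,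 d} : Finset (EuclideanSpace ℝ (Fin 3))) ∉ B) {v a b c d x y a' b' c' d' : EuclideanSpace ℝ (Fin 3)} (hv : v ∈ X)
    (hN : (∀ t, ({v, t} : Finset (EuclideanSpace ℝ (Fin 3))) ∈ B ↔ (t = a ∨ t = b ∨ t = c ∨ t = d))) (hd : (a ≠ b ∧ a ≠ c ∧ a ≠ d ∧ b ≠ c ∧ b ≠ d ∧ c ≠ d)) (hab : ({a, b} : Finset (EuclideanSpace ℝ (Fin 3))) ∈ B) (hcd : ({c, d} : Finset (EuclideanSpace ℝ (Fin 3))) ∈ B)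
    (hac : ({a, c} : Finset (EuclideanSpace ℝ (Fin 3))) ∉ B) (had : ({a, d} : Finset (EuclideanSpace ℝ (Fin 3))) ∉ B) (hbc : ({b, c} : Finset (EuclideanSpace ℝ (Fin 3))) ∉ B) (hbd : ({b, d} : Finset (EuclideanSpace ℝ (Fin 3))) ∉ B)
    (hNa : (∀ t, ({a, t} : Finset (EuclideanSpace ℝ (Fin 3))) ∈ B ↔ (t = v ∨ t = b ∨ t = x ∨ t = a'))) (hda : (v ≠ b ∧ v ≠ x ∧ v ≠ a' ∧ b ≠ x ∧ b ≠ a' ∧ x ≠ a')) (hxa' : ({x, a'} : Finset (EuclideanSpace ℝ (Fin 3))) ∈ B)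
    (hvxn : ({v, x} : Finset (EuclideanSpace ℝ (Fin 3))) ∉ B) (hvapn : ({v, a'} : Finset (EuclideanSpace ℝ (Fin 3))) ∉ B) (hbxn : ({b, x} : Finset (EuclideanSpace ℝ (Fin 3))) ∉ B) (hbapn : ({b, a'} : Finset (EuclideanSpace ℝ (Fin 3))) ∉ B)
    (hNb : (∀ t, ({b, t} : Finset (EuclideanSpace ℝ (Fin 3))) ∈ B ↔ (t = v ∨ t = a ∨ t = y ∨ t = b'))) (hdb : (v ≠ a ∧ v ≠ y ∧ v ≠ b' ∧ a ≠ y ∧ a ≠ b' ∧ y ≠ b')) (hyb' : ({y, b'} : Finset (EuclideanSpace ℝ (Fin 3))) ∈ B)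
    (hvyn : ({v, y} : Finset (EuclideanSpace ℝ (Fin 3))) ∉ B) (hvbpn : ({v, b'} : Finset (EuclideanSpace ℝ (Fin 3))) ∉ B) (hayn : ({a, y} : Finset (EuclideanSpace ℝ (Fin 3))) ∉ B) (habpn : ({a, b'} : Finset (EuclideanSpace ℝ (Fin 3))) ∉ B)
    (hNc : (∀ t, ({c, t} : Finset (EuclideanSpace ℝ (Fin 3))) ∈ B ↔ (t = v ∨ t = d ∨ t = x ∨ t = c'))) (hdc : (v ≠ d ∧ v ≠ x ∧ v ≠ c' ∧ d ≠ x ∧ d ≠ c' ∧ x ≠ c')) (hxc' : ({x, c'} : Finset (EuclideanSpace ℝ (Fin 3))) ∈ B)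
    (hvcpn : ({v, c'} : Finset (EuclideanSpace ℝ (Fin 3))) ∉ B) (hdxn : ({d, x} : Finset (EuclideanSpace ℝ (Fin 3))) ∉ B) (hdcpn : ({d, c'} : Finset (EuclideanSpace ℝ (Fin 3))) ∉ B)
    (hNd : (∀ t, ({d, t} : Finset (EuclideanSpace ℝ (Fin 3))) ∈ B ↔ (t = v ∨ t = c ∨ t = y ∨ t = d'))) (hdd : (v ≠ c ∧ v ≠ y ∧ v ≠ d' ∧ c ≠ y ∧ c ≠ d' ∧ y ≠ d')) (hyd' : ({y, d'} : Finset (EuclideanSpace ℝ (Fin 3))) ∈ B)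
    (hvdpn : ({v, d'} : Finset (EuclideanSpace ℝ (Fin 3))) ∉ B) (hcyn : ({c, y} : Finset (EuclideanSpace ℝ (Fin 3))) ∉ B) (hcdpn : ({c, d'} : Finset (EuclideanSpace ℝ (Fin 3))) ∉ B)
    (hNx : (∀ t, ({x, t} : Finset (EuclideanSpace ℝ (Fin 3))) ∈ B ↔ (t = a ∨ t = a' ∨ t = c ∨ t = c'))) (hdxx : (a ≠ a' ∧ a ≠ c ∧ a ≠ c' ∧ a' ≠ c ∧ a' ≠ c' ∧ c ≠ c'))
    (hacpn : ({a, c'} : Finset (EuclideanSpace ℝ (Fin 3))) ∉ B) (hapcn : ({a', c} : Finset (EuclideanSpace ℝ (Fin 3))) ∉ B) (hapcpn : ({a', c'} : Finset (EuclideanSpace ℝ (Fin 3))) ∉ B)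
    (hNy : (∀ t, ({y, t} : Finset (EuclideanSpace ℝ (Fin 3))) ∈ B ↔ (t = b ∨ t = b' ∨ t = d ∨ t = d'))) (hdyy : (b ≠ b' ∧ b ≠ d ∧ b ≠ d' ∧ b' ≠ d ∧ b' ≠ d' ∧ d ≠ d'))
    (hbdpn : ({b, d'} : Finset (EuclideanSpace ℝ (Fin 3))) ∉ B) (hbpdn : ({b', d} : Finset (EuclideanSpace ℝ (Fin 3))) ∉ B) (hbpdpn : ({b', d'} : Finset (EuclideanSpace ℝ (Fin 3))) ∉ B)
    (hxX : x ∈ X) (hyX : y ∈ X) (hxv : x ≠ v) (hxa : x ≠ a) (hxb : x ≠ b) (hxc : x ≠ c) (hxd : x ≠ d)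
    (hyv : y ≠ v) (hya : y ≠ a) (hyb : y ≠ b) (hyc : y ≠ c) (hyd : y ≠ d) (hxy : x ≠ y) :
    ({a', b'} : Finset (EuclideanSpace ℝ (Fin 3))) ∈ B := by
  have ha'd' := frame_ne hcard hB hdeg hallO hv hN hd hab hcd hac had hbc hbd hNa hda hxa' hvxn hvapn
    hbxn hbapn hNb hdb hyb' hvyn hvbpn hayn habpn hNc hdc hxc' hvcpn hdxn hdcpn hNd hdd hyd' hvdpn hcyn
    hcdpn hNx hdxx hacpn hapcn hapcpn hNy hdyy hbdpn hbpdn hbpdpn hxX hyX hxv hxa hxb hxc hxd hyv hya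
    hyb hyc hyd hxy
  have hva : ({v, a} : Finset (EuclideanSpace ℝ (Fin 3))) ∈ B := (hN a).2 (Or.inl rfl)
  have hvb : ({v, b} : Finset (EuclideanSpace ℝ (Fin 3))) ∈ B := (hN b).2 (Or.inr (Or.inl rfl))
  have haa' : ({a, a'} : Finset (EuclideanSpace ℝ (Fin 3))) ∈ B := (hNa a').2 (Or.inr (Or.inr (Or.inr rfl)))
  have haX : a ∈ X := (mem_of_mem_bonds hB hva).2
  -- `hα` at `v` for the pair `{a, b}` and at `a` for the pair `{v, b}`
  have hαv := alpha_of_allO hB hallO hva hvb hab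
  have hαa : ∀ z, ({z, v} : Finset (EuclideanSpace ℝ (Fin 3))) ∈ B → ({z, b} : Finset (EuclideanSpace ℝ (Fin 3))) ∈ B → z = a := fun z h1 h2 =>
    alpha_of_typeO hN hd hac had hbc hbd (by rw [Finset.pair_comm]; exact hva) hab hd.1 hvb h1 h2
      (ne_of_mem_bonds hB h2)
  have ha'b : a' ≠ b := hda.2.2.2.2.1.symm
  have ha'd : a' ≠ d := fun h => had (h ▸ haa')
  -- the cells at `a`
  rcases typeO_cells hT hX1 hcard hsepX hB hBcard hdeg haX hNa hda hvb hxa' hvxn hvapn hbxn hbapn hαa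
    with ⟨-, ⟨w, -, hwa, hwv, hwb, hwx, hwa', hB1, hB2⟩⟩ | ⟨⟨w, -, hwa, hwv, hwb, hwx, hwa', hB1, hB2⟩, -⟩
  · -- `w ∼ b`, `w ∼ a'`: `w = b'` (and `w = y` would put `a'` into `N(y)`)
    rcases (hNb w).1 (by rw [Finset.pair_comm]; exact hB1) with h | h | h | h
    · exact absurd h hwv
    · exact absurd h hwa
    · exfalso
      rw [h] at hB2
      rcases (hNy a').1 hB2 with e | e | e | e
      · exact ha'b e
      · exact habpn (e ▸ haa')
      · exact ha'd e
      · exact ha'd' e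
    · rw [h] at hB2; rw [Finset.pair_comm]; exact hB2
  · -- `w ∼ v`, `w ∼ a'`: `w ∈ {c, d}`, impossible
    exfalso
    rcases (hN w).1 (by rw [Finset.pair_comm]; exact hB1) with h | h | h | h
    · exact hwa h
    · exact hwb h
    · rw [h] at hB2
      rcases (hNc a').1 hB2 with e | e | e | e
      · exact hda.2.2.1 e.symm
      · exact ha'd e
      · exact hda.2.2.2.2.2 e.symm
      · exact hdxx.2.2.2.2.1 e
    · rw [h] at hB2
      rcases (hNd a').1 hB2 with e | e | e | e
      · exact hda.2.2.1 e.symm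
      · exact hdxx.2.2.2.1 e
      · exact hayn (e ▸ haa')
      · exact ha'd' e

end Setting

end Summit.AtomisticToContinuum.Crystallization.Theorems.Cap
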